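import Mathlib
import HarnessLib
import Summits.QuantumFields.YangMills.Theorems.PencilRigidityHypercubicLimitDefs
import Summits.QuantumFields.YangMills.Theorems.HypercubicLimit.Negative.ReflectedDensity
import Summits.QuantumFields.YangMills.Theorems.LangevinControlUVOSLegsFromFemtoAndGapStubAssemblyStrings
import Literature.MathematicalPhysics.AQFT.OSAxiomsSchwinger
import Literature.MathematicalPhysics.QuantumFieldTheory.OSData
import Literature.MathematicalPhysics.QuantumLattice.LatticeScalarField
import Literature.Probability.LatticeModels.ThermodynamicLimit

/-!
# Block BRIDGE of line `conditional-mean-telescoping` (crux stmt-QuantumFields-8646): `planeWeight` is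
the centred torus-plaquette string moment

Seat -1's Defs file (`Theorems/PencilRigidityHypercubicLimitDefs.lean`) defines the plane-string weight
`planeWeight r β S q x` as the sibling toolkit's `torusMomentStr` of the observables
`planeObs r (q i) = plaquetteObs r.ρ 0 (q i).1 (q i).2`, read through the translate `configShift (-(x i))`
of the periodic lift `torusLift (2S+1) U` and centred by the torus means `wilsonTorusMean`.  The c1 blocks
speak of the torus plaquette `torusPlaquette r (2S+1) i j x U = plaquetteObs r.ρ x i j (torusLift (2S+1) U)`
(`Theorems/HypercubicLimit/Negative/ReflectedDensity.lean`).  This file identifies the two: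
`planeWeight r β S q x = ∫ ∏ k (torusPlaquette r (2S+1) (q k).1 (q k).2 (x k) U − ⟨p_{q k}⟩) dμ`
(`μ` = Wilson's measure on the torus of side `2S+1`).

Proof: both integrands agree pointwise, factor by factor — the plaquette observable at the origin of the
translated periodic lift and the plaquette observable at `x` of the periodic lift are both
`Re tr r.ρ(U_p)` of the torus plaquette at the projected site `proj (2S+1) x`
(`CurvatureBoostCovariance.Negative.plaquetteObs_configShift_torusLift`,
`CurvatureBoostCovariance.Negative.plaquetteHolonomyZd_torusLift'`).
-/

noncomputable section

open scoped SchwartzMap ComplexConjugate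
open MeasureTheory Filter Topology
open Literature.MathematicalPhysics.AQFT Literature.MathematicalPhysics.QuantumLattice
open Literature.MathematicalPhysics.QuantumFieldTheory
open Literature.Probability.LatticeModels (box Site)
open Summit.QuantumFields.YangMills.Theorems.HypercubicLimit.Negative (torusPlaquette thetaZ)
open Summit.QuantumFields.YangMills.Theorems.OSLegsFromFemtoAndGap (torusMomentStr latticeDistStr latticeDist)

namespace Summit.QuantumFields.YangMills.Cruxes.HypercubicLimit.ConditionalMeanTelescoping

/-- (auxiliary, block BRIDGE) The single-plane plaquette field of orientation `p` at the origin of the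
translate by `-y` of the periodic lift of a torus configuration `U` is the torus plaquette of orientation
`p` based at `y`: both are `Re tr r.ρ(U_p)` of the plaquette of `U` at the projected site `proj L y`.
[folklore] -/
theorem pwEq_planeObs_configShift_torusLift {G : Type} [Group G] [TopologicalSpace G]
    [MeasurableSpace G] (r : LatticeRep G) (L : ℕ) (p : Fin 4 × Fin 4) (y : Site 4)
    (U : GaugeConfig 4 L G) :
    planeObs r p (configShift (-y) (torusLift L U)) = torusPlaquette r L p.1 p.2 y U := by
  rw [planeObs, Theorems.CurvatureBoostCovariance.Negative.plaquetteObs_configShift_torusLift,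
    torusPlaquette, plaquetteObs,
    Theorems.CurvatureBoostCovariance.Negative.plaquetteHolonomyZd_torusLift']

/-- **Block BRIDGE (`planeWeight` is the centred torus-plaquette string moment).** For every orientation
string `q` and corners `x`, seat -1's `planeWeight r β S q x` (the sibling toolkit's `torusMomentStr` of the
observables `planeObs r (q i) = plaquetteObs r.ρ 0 (q i).1 (q i).2`, read through `configShift (-(x i))` of the
periodic lift and centred by the torus means) equals the c1 blocks' moment
`∫ ∏ k (torusPlaquette r (2S+1) (q k).1 (q k).2 (x k) U − ⟨p_{q k}⟩) dμ`
(`plaquetteObs_configShift_torusLift`, `plaquetteHolonomyZd_torusLift'`). -/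
theorem rpBlock_planeWeightEq :
    ∀ (G : Type) [Group G] [TopologicalSpace G] [IsTopologicalGroup G] [CompactSpace G]
      [MeasurableSpace G] [BorelSpace G] (r : LatticeRep G) (β : ℝ) (S n : ℕ)
      (q : Fin n → Fin 4 × Fin 4) (x : Fin n → Site 4),
      planeWeight r β S q x =
        ∫ U, ∏ k, (torusPlaquette r (2 * S + 1) (q k).1 (q k).2 (x k) U -
            wilsonTorusMean r.ρ β S (planeObs r (q k)))
          ∂(wilsonMeasure r.ρ β : Measure (GaugeConfig 4 (2 * S + 1) G)) := by
  intro G _ _ _ _ _ _ r β S n q x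
  simp only [planeWeight, torusMomentStr, pwEq_planeObs_configShift_torusLift]

end Summit.QuantumFields.YangMills.Cruxes.HypercubicLimit.ConditionalMeanTelescoping

end
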